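import Summits.RiemannHypothesis.RiemannHypothesis.Theorems.MotivicDoorAWSIntegralCarrier

/-!
# AWS axiom system — evenness is free: an even integral carrier `ℤ^(ℕ) ⊕ ⟨e₁, e₂⟩` (cc-3 gen 12)

HONEST LABEL (verbatim on every AWS file).  One-way implication from a strengthened,
prime-side-only axiom system; the existence of such an object is NOT claimed and is the located
gap; the converse (RH ⇒ existence) is out of scope and, for this axiom system, tautological
rather than informative (AXIOM-CONTENT.md §2; `riemannHypothesis_iff_exists_tautologicalCarrier`,
`nonempty_arithmeticWeilSurface_iff_riemannHypothesis`).  VERDICT (AXIOM-CONTENT.md §0,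
referee-signed): `Nonempty ArithmeticWeilSurface` is a restatement of RH in structure clothing,
not a different-looking hypothesis.  Framing: lottery ticket at the motivic door; RH probability
negligible; consolation prizes are real: a new semi-local Weil-positivity theorem, or a located gap
in the Connes–Consani programme, plus the ff-door theorem.  Nothing in this file is evidence for RH.

## Content (sequel to `MotivicDoorAWSIntegralCarrier`, which settled INTEGRALITY)

Informal motivation (classical, NOT formalised here): on Weil's model surface `S = C × C`
(genus `g`, over `𝔽_q`) the canonical class is `K_S = p₁^*K_C + p₂^*K_C` (Hartshorne II
Ex. 8.3(b)), numerically `(2g - 2)(e₁ + e₂) ∈ 2 · Num(S)`, and the Riemann–Roch theorem for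
surfaces `χ(𝒪(D)) = χ(𝒪) + ½ D·(D − K_S)` (Hartshorne V Thm. 1.6; adjunction V Prop. 1.5) makes
`D·D ≡ D·K_S (mod 2)` for every divisor class; hence the numerical lattice `Num(C × C)` is an
EVEN integral lattice (free of finite rank) containing the hyperbolic plane `⟨e₁, e₂⟩`
(`e₁² = e₂² = 0`, `e₁·e₂ = 1`).  Of the "adjunction / Riemann–Roch" candidates for a separating
axiom named in AXIOM-CONTENT.md §3, this parity is the one that is a property of the bare
lattice-with-pairing.  This file shows, RH-FREE, that it is NOT separating either, and packages
the complete lattice-arithmetic profile of the decreed pairing: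

* `EvenCarrier.exists_generatingFamily_nat_dvd` (RH-free): for every `m ≥ 1` there is a generating
  family INDEXED BY `ℕ` (countable, with the density / forcing property) all of whose prime-side
  data are divisible as integers: the masses `∫ F_k d*u, ∫ F_k du ∈ mℤ` and the real cross terms
  `Re W(F_j ⋆ F̃_k) ∈ m²ℤ` (rescale and re-index the integral family of
  `IntegralCarrier.exists_integral_generatingFamily`; density is insensitive to rational
  rescaling and to re-indexing along a surjection).  So no congruence condition on the decreed
  Frobenius Gram data is an obstruction.
* `EvenCarrier.primeInter_self_even`: if the masses are integers and the cross terms are EVEN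
  integers, the decreed pairing of the canonical prime-side carrier (`AWS.PrimeSideLattice`) is an
  even integral pairing: `x·x ∈ 2ℤ` for every lattice vector.
* `EvenCarrier.exists_even_free_primeLattice` (RH-free): a generating family indexed by `ℕ` whose
  canonical carrier `(ℕ →₀ ℤ) × ℤ × ℤ = ℤ^(ℕ) ⊕ ℤe₁ ⊕ ℤe₂` has a `ℤ`-valued, EVEN decreed pairing.
* `EvenCarrier.riemannHypothesis_iff_exists_even_free_carrier` (kernel-exact, for literally the
  structure `ArithmeticWeilSurface`):
  `RH ↔ ∃ X, (X.L ≃+ ℤ^(ℕ) ⊕ ℤ ⊕ ℤ with e₁ ↦ (0,1,0), e₂ ↦ (0,0,1)) ∧ (x·y ∈ ℤ) ∧ (x·x ∈ 2ℤ)`: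
  requiring the lattice to be free abelian of countably infinite rank with the hyperbolic plane a
  direct summand, and the pairing to be integral and even, adds NOTHING to the axiom system —
  given RH the canonical carrier has all of it; without RH no carrier exists
  (`riemannHypothesis_of_arithmeticWeilSurface`).  (Infinite rank is forced:
  `ArithmeticWeilSurface.aleph0_le_rank`; so `ℤ^(ℕ) ⊕ U` is the sharpest possible shape.)
* `EvenCarrier.riemannHypothesis_iff_exists_carrier_frobData_dvd`: likewise for "all decreed
  Frobenius data `D(φ_i)·D(φ_j)`, `D(φ_i)·e₁`, `D(φ_i)·e₂` divisible by `m`", any `m ≥ 1`.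

The located gap is unchanged: an axiom the tautological carrier cannot satisfy must involve MORE
than the lattice, its pairing and congruences — an effective cone / ampleness with a Riemann–Roch
INEQUALITY, or a geometric origin of the sign condition (AXIOM-CONTENT.md §3).

References: A. Weil (1948); A. Mattuck, J. Tate, Abh. Math. Sem. Hamburg 22 (1958);
A. Grothendieck, J. reine angew. Math. 200 (1958); R. Hartshorne, Algebraic Geometry (GTM 52,
1977), II Ex. 8.3(b), V Prop. 1.5, Thm. 1.6, Ex. 1.9–1.10; W. Barth, C. Peters, A. Van de Ven,
Compact Complex Surfaces (1984) (Wu's formula: evenness of the intersection form when `c₁ ≡ 0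
(mod 2)`); A. Connes, C. Consani, arXiv:1805.10501 §3; E. Bombieri, Rend. Mat. Acc. Lincei (9) 11
(2000).
-/

noncomputable section

open Complex Set MeasureTheory Literature.NumberTheory.LFunctions
open Literature.NumberTheory.ConnesConsani2019
open Summit.RiemannHypothesis.RiemannHypothesis.Theorems.PfPersistence (weilCross)
open scoped BigOperators

namespace Summit.RiemannHypothesis.RiemannHypothesis.Theorems.MotivicDoor.AWS

-- the mandated namespace repeats a component (single-conjunct summit)
set_option linter.dupNamespace false

namespace EvenCarrier

/-! ## §1 Elementary identities for rescaled / re-indexed combinations -/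

/-- Integer combinations of the rescaled generators `m φ_i` are `m` times the combinations. -/
theorem testCombination_constMul {ι : Type*} (φ : ι → ℝ → ℝ) (m : ℝ) (c : ι →₀ ℤ) (t : ℝ) :
    testCombination (fun i s ↦ m * φ i s) c t = m * testCombination φ c t := by
  simp only [testCombination, Finsupp.sum, Finset.mul_sum]
  exact Finset.sum_congr rfl fun i _ ↦ by ring

/-- A generating family has at least one generator (density applied to a bump at `0`). -/
theorem nonempty_index (G : GeneratingFamily) : Nonempty G.ι := by
  by_contra hι
  haveI : IsEmpty G.ι := not_nonempty_iff.mp hι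
  let b : ContDiffBump (0 : ℝ) := ⟨1, 2, one_pos, one_lt_two⟩
  obtain ⟨R, -, -, h⟩ := G.dense (fun t ↦ b t) (isWeilTest_contDiffBump b)
  obtain ⟨N, c, -, -, h0, -⟩ := h (1 / 2) (by norm_num)
  have hc : c = 0 := Subsingleton.elim c 0
  have hb0 : b 0 = 1 := b.one_of_mem_closedBall (by simp [b])
  have h00 := h0 0
  rw [hc, hb0] at h00
  simp [testCombination] at h00
  norm_num at h00

/-- The data of a single rescaled generator, through the `ℝ`-linear prime-side maps of
`AWS.CanonicalCarrierForm`: first mass. -/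
theorem massDstar_constMul (G : GeneratingFamily) (m : ℝ) (i : G.ι) :
    massDstar (toMul fun t ↦ m * G.φ i t) = m * massDstar (toMul (G.φ i)) := by
  have h1 : (fun t ↦ m * G.φ i t) = G.rtest (Finsupp.single i m) :=
    (IntegralAux.rtest_single G i m).symm
  have h2 : G.φ i = G.rtest (Finsupp.single i 1) := by
    rw [IntegralAux.rtest_single]; funext t; ring
  rw [h1, h2, ← G.M₀_eq_massDstar, ← G.M₀_eq_massDstar, ← Finsupp.smul_single_one i m,
    map_smul, smul_eq_mul]

/-- Second mass of a rescaled generator. -/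
theorem massDu_constMul (G : GeneratingFamily) (m : ℝ) (i : G.ι) :
    massDu (toMul fun t ↦ m * G.φ i t) = m * massDu (toMul (G.φ i)) := by
  have h1 : (fun t ↦ m * G.φ i t) = G.rtest (Finsupp.single i m) :=
    (IntegralAux.rtest_single G i m).symm
  have h2 : G.φ i = G.rtest (Finsupp.single i 1) := by
    rw [IntegralAux.rtest_single]; funext t; ring
  rw [h1, h2, ← G.M₁_eq_massDu, ← G.M₁_eq_massDu, ← Finsupp.smul_single_one i m,
    map_smul, smul_eq_mul]

/-- Cross term of two rescaled generators: `Re W((mφ_i) ⋆ (mφ_j)~) = m² Re W(φ_i ⋆ φ̃_j)`. -/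
theorem weilCross_re_constMul (G : GeneratingFamily) (m : ℝ) (i j : G.ι) :
    (weilCross (fun t ↦ ((m * G.φ i t : ℝ) : ℂ)) (fun t ↦ ((m * G.φ j t : ℝ) : ℂ))).re =
      m ^ 2 * (weilCross (fun t ↦ (G.φ i t : ℂ)) (fun t ↦ (G.φ j t : ℂ))).re := by
  have h1 : ∀ k : G.ι, (fun t ↦ ((m * G.φ k t : ℝ) : ℂ)) =
      fun t ↦ (G.rtest (Finsupp.single k m) t : ℂ) := fun k ↦ by
    rw [IntegralAux.rtest_single]
  have h2 : ∀ k : G.ι, (fun t ↦ (G.φ k t : ℂ)) =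
      fun t ↦ (G.rtest (Finsupp.single k 1) t : ℂ) := fun k ↦ by
    rw [IntegralAux.rtest_single]; funext t; simp
  have key : ∀ a b : G.ι →₀ ℝ, (weilCross (fun t ↦ (G.rtest a t : ℂ))
      (fun t ↦ (G.rtest b t : ℂ))).re = G.Wc a b := fun a b ↦ rfl
  rw [h1 i, h1 j, h2 i, h2 j, key, key, ← Finsupp.smul_single_one i m,
    ← Finsupp.smul_single_one j m]
  simp only [map_smul, LinearMap.smul_apply, smul_eq_mul]
  ring

/-! ## §2 A generating family indexed by `ℕ` with all prime-side data divisible by `m` (RH-free) -/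

/-- **Congruences are free (RH-free).**  For every `m ≥ 1` there is a generating family indexed
by `ℕ` (so countable; density / forcing property included) with ALL prime-side data divisible:
masses `∫ F_k d*u, ∫ F_k du ∈ mℤ` and cross terms `Re W(F_j ⋆ F̃_k) ∈ m²ℤ` (in particular, for
`m = 2`, even self-terms `Re Q(F_k) ∈ 4ℤ`).  Construction: the integral family of
`IntegralCarrier.exists_integral_generatingFamily`, re-indexed along a surjection `ℕ → ι` and
rescaled by `m`; the density axiom survives because it only asks for rational multiples
`N⁻¹ u_c` (`N ↦ mN`) and because re-indexing along a surjection loses no combination. -/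
theorem exists_generatingFamily_nat_dvd (m : ℕ) (hm : 0 < m) :
    ∃ F : GeneratingFamily, Nonempty (F.ι ≃ ℕ) ∧
      (∀ i, ∃ z : ℤ, massDstar (toMul (F.φ i)) = m * z) ∧
      (∀ i, ∃ z : ℤ, massDu (toMul (F.φ i)) = m * z) ∧
      ∀ i j, ∃ z : ℤ,
        (weilCross (fun t ↦ (F.φ i t : ℂ)) (fun t ↦ (F.φ j t : ℂ))).re = (m : ℝ) ^ 2 * z := by
  classical
  obtain ⟨G, hGc, h₀, h₁, h₂⟩ := IntegralCarrier.exists_integral_generatingFamily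
  haveI := hGc
  haveI := nonempty_index G
  -- a surjective enumeration of the generators and a section of it
  obtain ⟨enum, henum⟩ := exists_surjective_nat G.ι
  let sec : G.ι → ℕ := Function.surjInv henum
  have hsec : ∀ i, enum (sec i) = i := Function.surjInv_eq henum
  have hsec_inj : Function.Injective sec := Function.injective_surjInv henum
  -- the rescaled, re-indexed generators
  let ψ : ℕ → ℝ → ℝ := fun n t ↦ (m : ℝ) * G.φ (enum n) t
  have hψG : ∀ c : G.ι →₀ ℤ, testCombination ψ (c.mapDomain sec) =
      fun t ↦ (m : ℝ) * testCombination G.φ c t := fun c ↦ by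
    rw [IntegralCarrier.testCombination_mapDomain ψ sec hsec_inj]
    funext t
    rw [show ψ ∘ sec = fun i s ↦ (m : ℝ) * G.φ i s from funext fun i ↦ by
      simp only [Function.comp_apply, ψ, hsec]]
    exact testCombination_constMul G.φ m c t
  have hm0 : (m : ℝ) ≠ 0 := by exact_mod_cast hm.ne'
  let F : GeneratingFamily :=
    { ι := ℕ
      φ := ψ
      isWeilTest := fun n ↦ by
        simpa [ψ, Complex.ofReal_mul] using (G.isWeilTest (enum n)).const_mul ((m : ℝ) : ℂ)
      dense := by
        intro u hu
        obtain ⟨R, hR, hsu, h⟩ := G.dense u hu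
        refine ⟨R, hR, hsu, fun ε hε ↦ ?_⟩
        obtain ⟨N, c, hN, hsc, hv, hd⟩ := h ε hε
        have hscale : (fun s ↦ ((m * N : ℕ) : ℝ)⁻¹ * testCombination ψ (c.mapDomain sec) s) =
            fun s ↦ (N : ℝ)⁻¹ * testCombination G.φ c s := by
          funext s
          rw [hψG c]
          push_cast
          field_simp
        refine ⟨m * N, c.mapDomain sec, Nat.mul_pos hm hN, ?_, fun t ↦ ?_, fun t ↦ ?_⟩
        · rw [hψG c]
          exact (tsupport_mul_subset_right (f := fun _ : ℝ ↦ (m : ℝ))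
            (g := testCombination G.φ c)).trans hsc
        · rw [show ((m * N : ℕ) : ℝ)⁻¹ * testCombination ψ (c.mapDomain sec) t =
              (N : ℝ)⁻¹ * testCombination G.φ c t from congrFun hscale t]
          exact hv t
        · rw [hscale]
          exact hd t }
  refine ⟨F, ⟨Equiv.refl ℕ⟩, fun n ↦ ?_, fun n ↦ ?_, fun n k ↦ ?_⟩
  · obtain ⟨z, hz⟩ := h₀ (enum n)
    refine ⟨z, ?_⟩
    change massDstar (toMul fun t ↦ (m : ℝ) * G.φ (enum n) t) = _
    rw [massDstar_constMul, hz]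
  · obtain ⟨z, hz⟩ := h₁ (enum n)
    refine ⟨z, ?_⟩
    change massDu (toMul fun t ↦ (m : ℝ) * G.φ (enum n) t) = _
    rw [massDu_constMul, hz]
  · obtain ⟨z, hz⟩ := h₂ (enum n) (enum k)
    refine ⟨z, ?_⟩
    change (weilCross (fun t ↦ (((m : ℝ) * G.φ (enum n) t : ℝ) : ℂ))
      (fun t ↦ (((m : ℝ) * G.φ (enum k) t : ℝ) : ℂ))).re = _
    rw [weilCross_re_constMul, hz]

/-! ## §3 Even pairing on the canonical carrier -/

/-- A biadditive real form on the free lattice with values in `mℤ` on pairs of basis vectors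
takes values in `mℤ` everywhere. -/
theorem dvd_of_biadditive {ι : Type*} (f : (ι →₀ ℤ) →+ (ι →₀ ℤ) →+ ℝ) {m : ℝ} (hm : m ≠ 0)
    (h : ∀ i j, ∃ z : ℤ, f (Finsupp.single i 1) (Finsupp.single j 1) = m * z) (c c' : ι →₀ ℤ) :
    ∃ z : ℤ, f c c' = m * z := by
  let g : (ι →₀ ℤ) →+ (ι →₀ ℤ) →+ ℝ :=
    (AddMonoidHom.compHom (AddMonoidHom.mulLeft m⁻¹)).comp f
  have hg : ∀ x y, g x y = m⁻¹ * f x y := fun x y ↦ rfl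
  obtain ⟨z, hz⟩ := IntegralCarrier.int_of_biadditive g (fun i j ↦ by
    obtain ⟨z, hz⟩ := h i j
    exact ⟨z, by rw [hg, hz, inv_mul_cancel_left₀ hm]⟩) c c'
  refine ⟨z, ?_⟩
  rw [hg] at hz
  calc f c c' = m * (m⁻¹ * f c c') := by rw [mul_inv_cancel_left₀ hm]
    _ = m * z := by rw [hz]

/-- **The decreed pairing of the canonical carrier is EVEN** as soon as the masses of the
generators are integers and the real cross terms `Re W(φ_i ⋆ φ̃_j)` are even integers:
`x·x ∈ 2ℤ` for every `x` in the prime-side lattice `(ι →₀ ℤ) × ℤ × ℤ`.  (On the diagonal,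
`x·x = 2 d*(c) d_u(c) − Re W(u_c ⋆ ũ_c) + 2a d*(c) + 2b d_u(c) + 2ab` for `x = (c, a, b)`.) -/
theorem primeInter_self_even (G : GeneratingFamily)
    (h₀ : ∀ i, ∃ z : ℤ, massDstar (toMul (G.φ i)) = z)
    (h₁ : ∀ i, ∃ z : ℤ, massDu (toMul (G.φ i)) = z)
    (h₂ : ∀ i j, ∃ z : ℤ,
      (weilCross (fun t ↦ (G.φ i t : ℂ)) (fun t ↦ (G.φ j t : ℂ))).re = 2 * z)
    (x : G.PrimeLattice) : ∃ z : ℤ, G.primeInter x x = 2 * z := by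
  have hd : ∀ c, ∃ z : ℤ, G.dstarHom c = z := IntegralCarrier.int_of_additive G.dstarHom fun i ↦ by
    rw [G.dstarHom_apply, ForcingUp.testCombination_single]; exact h₀ i
  have hu : ∀ c, ∃ z : ℤ, G.duHom c = z := IntegralCarrier.int_of_additive G.duHom fun i ↦ by
    rw [G.duHom_apply, ForcingUp.testCombination_single]; exact h₁ i
  have hc : ∀ c c', ∃ z : ℤ, G.crossHom c c' = 2 * z :=
    dvd_of_biadditive G.crossHom two_ne_zero fun i j ↦ by
      rw [G.crossHom_apply]
      change ∃ z : ℤ, (weilCross (fun t ↦ ((testCombination G.φ (Finsupp.single i 1) t : ℝ) : ℂ))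
        (fun t ↦ ((testCombination G.φ (Finsupp.single j 1) t : ℝ) : ℂ))).re = 2 * z
      rw [ForcingUp.testCombination_single, ForcingUp.testCombination_single]; exact h₂ i j
  obtain ⟨z₁, e₁⟩ := hd x.1
  obtain ⟨z₄, e₄⟩ := hu x.1
  obtain ⟨z₅, e₅⟩ := hc x.1 x.1
  refine ⟨z₁ * z₄ - z₅ + x.2.1 * z₁ + x.2.2 * z₄ + x.2.1 * x.2.2, ?_⟩
  rw [G.primeInter_apply, GeneratingFamily.interFun, e₁, e₄, e₅]
  push_cast
  ring

/-- Integrality from divisible data (bookkeeping: `m z` is an integer). -/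
theorem primeInter_integral_of_dvd (G : GeneratingFamily) (m : ℕ)
    (h₀ : ∀ i, ∃ z : ℤ, massDstar (toMul (G.φ i)) = m * z)
    (h₁ : ∀ i, ∃ z : ℤ, massDu (toMul (G.φ i)) = m * z)
    (h₂ : ∀ i j, ∃ z : ℤ,
      (weilCross (fun t ↦ (G.φ i t : ℂ)) (fun t ↦ (G.φ j t : ℂ))).re = (m : ℝ) ^ 2 * z)
    (x y : G.PrimeLattice) : ∃ z : ℤ, G.primeInter x y = z := by
  refine IntegralCarrier.primeInter_integral G (fun i ↦ ?_) (fun i ↦ ?_) (fun i j ↦ ?_) x y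
  · obtain ⟨z, hz⟩ := h₀ i; exact ⟨m * z, by rw [hz]; push_cast; ring⟩
  · obtain ⟨z, hz⟩ := h₁ i; exact ⟨m * z, by rw [hz]; push_cast; ring⟩
  · obtain ⟨z, hz⟩ := h₂ i j; exact ⟨m ^ 2 * z, by rw [hz]; push_cast; ring⟩

/-- **An even integral canonical carrier `ℤ^(ℕ) ⊕ ℤe₁ ⊕ ℤe₂` exists (RH-free).**  There is a
generating family indexed by `ℕ` whose canonical prime-side carrier — the free abelian group
`(ℕ →₀ ℤ) × ℤ × ℤ` with the rulings `(0,1,0)`, `(0,0,1)` — has a `ℤ`-valued and EVEN decreed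
pairing. -/
theorem exists_even_free_primeLattice : ∃ G : GeneratingFamily, Nonempty (G.ι ≃ ℕ) ∧
    (∀ x y : G.PrimeLattice, ∃ z : ℤ, G.primeInter x y = z) ∧
    ∀ x : G.PrimeLattice, ∃ z : ℤ, G.primeInter x x = 2 * z := by
  obtain ⟨G, hG, h₀, h₁, h₂⟩ := exists_generatingFamily_nat_dvd 2 two_pos
  refine ⟨G, hG, primeInter_integral_of_dvd G 2 h₀ h₁ h₂,
    primeInter_self_even G (fun i ↦ ?_) (fun i ↦ ?_) (fun i j ↦ ?_)⟩
  · obtain ⟨z, hz⟩ := h₀ i; exact ⟨2 * z, by rw [hz]; push_cast; ring⟩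
  · obtain ⟨z, hz⟩ := h₁ i; exact ⟨2 * z, by rw [hz]; push_cast; ring⟩
  · obtain ⟨z, hz⟩ := h₂ i j; exact ⟨2 * z, by rw [hz]; push_cast; ring⟩

/-! ## §4 The kernel-exact equivalences for the structure `ArithmeticWeilSurface` -/

/-- **EVENNESS AND FREENESS OF THE LATTICE ARE NOT THE MISSING AXIOM** (kernel-exact for
literally the structure `ArithmeticWeilSurface`): `RH ↔` there is an arithmetic Weil surface
whose lattice is the free abelian group `ℤ^(ℕ) ⊕ ℤe₁ ⊕ ℤe₂` (countably infinite rank, the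
hyperbolic plane a direct summand with `e₁ ↦ (0,1,0)`, `e₂ ↦ (0,0,1)`) and whose intersection
pairing is INTEGRAL and EVEN.  Forward: the even canonical carrier of
`exists_generatingFamily_nat_dvd 2`, its sign condition supplied by RH
(`primeHodge_iff_riemannHypothesis`); backward: `riemannHypothesis_of_arithmeticWeilSurface`.
(Infinite rank is forced on every carrier, `ArithmeticWeilSurface.aleph0_le_rank`.) -/
theorem riemannHypothesis_iff_exists_even_free_carrier :
    _root_.RiemannHypothesis ↔
      ∃ X : ArithmeticWeilSurface,
        (∃ f : X.L ≃+ (ℕ →₀ ℤ) × ℤ × ℤ, f X.e₁ = (0, 1, 0) ∧ f X.e₂ = (0, 0, 1)) ∧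
        (∀ x y : X.L, ∃ n : ℤ, X.inter x y = n) ∧
        ∀ x : X.L, ∃ n : ℤ, X.inter x x = 2 * n := by
  constructor
  · intro hRH
    obtain ⟨G, ⟨e⟩, h₀, h₁, h₂⟩ := exists_generatingFamily_nat_dvd 2 two_pos
    have hint := primeInter_integral_of_dvd G 2 h₀ h₁ h₂
    have heven : ∀ x : G.PrimeLattice, ∃ z : ℤ, G.primeInter x x = 2 * z :=
      primeInter_self_even G
        (fun i ↦ by obtain ⟨z, hz⟩ := h₀ i; exact ⟨2 * z, by rw [hz]; push_cast; ring⟩)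
        (fun i ↦ by obtain ⟨z, hz⟩ := h₁ i; exact ⟨2 * z, by rw [hz]; push_cast; ring⟩)
        (fun i j ↦ by obtain ⟨z, hz⟩ := h₂ i j; exact ⟨2 * z, by rw [hz]; push_cast; ring⟩)
    -- the re-indexing isomorphism `(ι →₀ ℤ) × ℤ × ℤ ≃+ (ℕ →₀ ℤ) × ℤ × ℤ` along `e`
    let f : G.PrimeLattice ≃+ (ℕ →₀ ℤ) × ℤ × ℤ :=
      AddEquiv.prodCongr (Finsupp.domCongr e) (AddEquiv.refl (ℤ × ℤ))
    have hf : ∀ x : G.PrimeLattice, f x = (Finsupp.domCongr e x.1, x.2) := fun x ↦ rfl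
    refine ⟨G.ofHodge (G.primeHodge_iff_riemannHypothesis.mpr hRH), ⟨f, ?_, ?_⟩,
      fun x y ↦ hint x y, fun x ↦ heven x⟩
    · change f G.primeE₁ = _
      rw [hf]
      simp [GeneratingFamily.primeE₁]
    · change f G.primeE₂ = _
      rw [hf]
      simp [GeneratingFamily.primeE₂]
  · rintro ⟨X, -, -, -⟩
    exact riemannHypothesis_of_arithmeticWeilSurface ⟨X⟩

/-- The pairings of the Frobenius classes of the canonical carrier with each other and with the
rulings are the prime-side data of single generators. -/
theorem primeInter_primeFrob_primeFrob (G : GeneratingFamily) (i j : G.ι) :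
    G.primeInter (G.primeFrob i) (G.primeFrob j) =
      massDstar (toMul (G.φ i)) * massDu (toMul (G.φ j)) +
        massDstar (toMul (G.φ j)) * massDu (toMul (G.φ i)) -
        (weilCross (fun t ↦ (G.φ i t : ℂ)) (fun t ↦ (G.φ j t : ℂ))).re := by
  rw [G.primeInter_apply, GeneratingFamily.interFun]
  simp only [GeneratingFamily.primeFrob, Int.cast_zero, zero_mul, add_zero]
  rw [G.dstarHom_apply, G.dstarHom_apply, G.duHom_apply, G.duHom_apply, G.crossHom_apply,
    ForcingUp.testCombination_single, ForcingUp.testCombination_single]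
  change _ - (weilCross (fun t ↦ ((testCombination G.φ (Finsupp.single i 1) t : ℝ) : ℂ))
    (fun t ↦ ((testCombination G.φ (Finsupp.single j 1) t : ℝ) : ℂ))).re = _
  rw [ForcingUp.testCombination_single, ForcingUp.testCombination_single]

/-- Frobenius class against the first ruling: the first mass `∫ φ_i d*u`. -/
theorem primeInter_primeFrob_primeE₁ (G : GeneratingFamily) (i : G.ι) :
    G.primeInter (G.primeFrob i) G.primeE₁ = massDstar (toMul (G.φ i)) := by
  rw [G.primeInter_apply, GeneratingFamily.interFun]
  simp only [GeneratingFamily.primeFrob, GeneratingFamily.primeE₁, map_zero, Int.cast_zero,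
    Int.cast_one, zero_mul, mul_zero, one_mul, add_zero, zero_add, sub_zero]
  rw [G.dstarHom_apply, ForcingUp.testCombination_single]

/-- Frobenius class against the second ruling: the second mass `∫ φ_i du`. -/
theorem primeInter_primeFrob_primeE₂ (G : GeneratingFamily) (i : G.ι) :
    G.primeInter (G.primeFrob i) G.primeE₂ = massDu (toMul (G.φ i)) := by
  rw [G.primeInter_apply, GeneratingFamily.interFun]
  simp only [GeneratingFamily.primeFrob, GeneratingFamily.primeE₂, map_zero, Int.cast_zero,
    Int.cast_one, zero_mul, mul_zero, one_mul, add_zero, zero_add, sub_zero]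
  rw [G.duHom_apply, ForcingUp.testCombination_single]

/-- **NO CONGRUENCE ON THE DECREED FROBENIUS DATA IS AN OBSTRUCTION** (kernel-exact): for every
`m ≥ 1`, `RH ↔` there is an arithmetic Weil surface all of whose decreed Frobenius data
`D(φ_i)·D(φ_j)`, `D(φ_i)·e₁`, `D(φ_i)·e₂` are integers divisible by `m`. -/
theorem riemannHypothesis_iff_exists_carrier_frobData_dvd (m : ℕ) (hm : 0 < m) :
    _root_.RiemannHypothesis ↔
      ∃ X : ArithmeticWeilSurface,
        (∀ i j, ∃ z : ℤ, X.inter (X.frob i) (X.frob j) = m * z) ∧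
        (∀ i, ∃ z : ℤ, X.inter (X.frob i) X.e₁ = m * z) ∧
        ∀ i, ∃ z : ℤ, X.inter (X.frob i) X.e₂ = m * z := by
  constructor
  · intro hRH
    obtain ⟨G, -, h₀, h₁, h₂⟩ := exists_generatingFamily_nat_dvd m hm
    refine ⟨G.ofHodge (G.primeHodge_iff_riemannHypothesis.mpr hRH), fun i j ↦ ?_, fun i ↦ ?_,
      fun i ↦ ?_⟩
    · obtain ⟨a, ha⟩ := h₀ i; obtain ⟨b, hb⟩ := h₁ j; obtain ⟨a', ha'⟩ := h₀ j
      obtain ⟨b', hb'⟩ := h₁ i; obtain ⟨w, hw⟩ := h₂ i j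
      refine ⟨m * (a * b) + m * (a' * b') - m * w, ?_⟩
      change G.primeInter (G.primeFrob i) (G.primeFrob j) = _
      rw [primeInter_primeFrob_primeFrob, ha, hb, ha', hb', hw]
      push_cast
      ring
    · obtain ⟨a, ha⟩ := h₀ i
      refine ⟨a, ?_⟩
      change G.primeInter (G.primeFrob i) G.primeE₁ = _
      rw [primeInter_primeFrob_primeE₁, ha]
    · obtain ⟨b, hb⟩ := h₁ i
      refine ⟨b, ?_⟩
      change G.primeInter (G.primeFrob i) G.primeE₂ = _
      rw [primeInter_primeFrob_primeE₂, hb]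
  · rintro ⟨X, -, -, -⟩
    exact riemannHypothesis_of_arithmeticWeilSurface ⟨X⟩

end EvenCarrier

end Summit.RiemannHypothesis.RiemannHypothesis.Theorems.MotivicDoor.AWS
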